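import Summits.BirchSwinnertonDyer.Rank1Residual.P2.CongruentNumberSilentEvenFiveThetaCMClassField
import HarnessLib

/-!
# Cell `bsd-monsky`, route B: C-P2-1 on `𝒮⁻` from {`tyz_cmPointClassFieldData`, `hSel`} — the split display plus the
# explicit `2`-descent bound `#Sel₂(E_{2pq}) ≤ 8` (kernel theorems; nothing asserted)

HONEST FRAMING (cell `bsd-monsky`, run/shared/lean/pub/bsd-monsky/; README §1): nothing is booked by this file.  The corner of
`…ThetaCMClassField.lean` (p467557, offered in OFFER-M v1.8 §(vii′)) takes the `2`-Selmer input as Aoki 1999 Thm. 2.2 (`hAo`)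
or Monsky's even count (`hMe`).  THIS file (a separate leaf, so that the offered file's bytes stay fixed) records the third
form: the `2`-Selmer input DISPLAYED as the in-house `2`-descent statement `hSel : #Sel₂(E_{2pq}) ≤ 8` on `𝒮⁻` — the slot for a
tree theorem of the explicit `2`-descent (the cell's descent–Kummer bridge, prover-A, in progress): once `#Sel₂(E_{2pq}) ≤ 8` is
proved in the tree, C-P2-1 on `𝒮⁻` rests on the ONE Literature display `tyz_cmPointClassFieldData`, every displayed sentence of
which is printed (TYZ §3 + Cox Thm. 6.1 (ii) / Thm. 9.18).  One-line compositions of `…GenusParity.lean`'s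
`…_of_thetaDisplay_of_selmer_le_eight` with `thetaDisplay_of_cmPointClassFieldData`.  CONDITIONAL; nothing asserted.
[cite: TianYuanZhang2017, §3.1, Prop. 3.2, Thm. 3.5, Thm. 3.6, Lemma 3.21] [cite: Cox2013, Theorem 6.1 (ii) and Theorem 9.18]
[cite: SilvermanAEC2009, Thm. X.4.2] [cite: Miller2011LMS, Def. 1.1 (arXiv:1010.2431 p. 3)]
-/

noncomputable section

open scoped Classical

open WeierstrassCurve NumberField Literature.NumberTheory.EllipticCurves
  Literature.NumberTheory.EllipticCurves.TianYuanZhang2017 Literature.NumberTheory.EllipticCurves.Aoki1999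
  Literature.NumberTheory.EllipticCurves.HeathBrown1994 Literature.NumberTheory.QuadraticFields

namespace Summit.BirchSwinnertonDyer.Rank1Residual.P2

open ThetaDescent Conjectures

/-! ## The corner with the `2`-Selmer input as an explicit `2`-descent statement (`hSel`: `#Sel₂(E_{2pq}) ≤ 8` on `𝒮⁻`) -/

/-- **C-P2-1, sharper form, on `𝒮⁻` from {`tyz_cmPointClassFieldData`, `hSel`}** — the `2`-Selmer input DISPLAYED as the
in-house `2`-descent statement `#Sel₂(E_{2pq}) ≤ 8` on `𝒮⁻` (the slot for a tree theorem of the explicit `2`-descent — cf.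
the cell's descent–Kummer bridge in progress — in place of Aoki Thm. 2.2 / hMe); no Rédei–Reichardt, no GZK, no Monsky
1990. CONDITIONAL; nothing asserted. [cite: TianYuanZhang2017, §1 ((1.1)), Thm. 3.5, Prop. 3.2, Thm. 3.6]
[cite: Cox2013, Theorem 6.1 (ii) and Theorem 9.18] [cite: Miller2011LMS, Def. 1.1 (arXiv:1010.2431 p. 3)] -/
theorem congruentSilentEvenFiveOrdTwo_of_cmPointClassFieldData_of_selmer_le_eight (hCF : tyz_cmPointClassFieldData)
    (hSel : ∀ p q : ℕ, p.Prime → q.Prime → p % 8 = 5 → q % 4 = 3 → jacobiSym p q = -1 →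
      Nat.card ((congruentNumberCurve (2 * (p * q))).selmerGroup 2) ≤ 8) :
    CongruentSilentEvenFiveOrdTwo :=
  congruentSilentEvenFiveOrdTwo_of_thetaDisplay_of_selmer_le_eight (thetaDisplay_of_cmPointClassFieldData hCF) hSel

/-- **C-P2-1, observable form (`ord_{s=1} L(E_{2pq}, s) = 1 ∧ BSD(E_{2pq}, 2)` on `𝒮⁻`) from {`tyz_cmPointClassFieldData`,
`hSel`}** — ONE Literature display whose every conjunct is a printed sentence, plus the explicit `2`-descent bound
`#Sel₂(E_{2pq}) ≤ 8`; when the latter is a tree theorem this is the corner from a single named fact. CONDITIONAL; nothing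
asserted. [cite: TianYuanZhang2017, §1 ((1.1)), Thm. 3.5, Prop. 3.2, Thm. 3.6] [cite: Cox2013, Theorem 6.1 (ii) and Theorem 9.18]
[cite: SilvermanAEC2009, Thm. X.4.2] [cite: Miller2011LMS, Def. 1.1 (arXiv:1010.2431 p. 3)] -/
theorem congruentSilentEvenFiveBSDTwo_of_cmPointClassFieldData_of_selmer_le_eight (hCF : tyz_cmPointClassFieldData)
    (hSel : ∀ p q : ℕ, p.Prime → q.Prime → p % 8 = 5 → q % 4 = 3 → jacobiSym p q = -1 →
      Nat.card ((congruentNumberCurve (2 * (p * q))).selmerGroup 2) ≤ 8) :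
    CongruentSilentEvenFiveBSDTwo :=
  congruentSilentEvenFiveBSDTwo_of_thetaDisplay_of_selmer_le_eight (thetaDisplay_of_cmPointClassFieldData hCF) hSel

end Summit.BirchSwinnertonDyer.Rank1Residual.P2

end
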